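import Literature.NumberTheory.LFunctions.LargeValuesS2Bound
import Literature.NumberTheory.LFunctions.GuthMaynardSimpleS3BoundProofs
import HarnessLib

/-!
# Guth–Maynard Proposition 6.1 (the `S₂` bound) with `T` free (at `k = 4`)

NOT RH-BEARING (D-0040; bears_on LADDER-RH §4 HELD `DensityLadder`): a large-values / zero-density result
counts zeros off the critical line, it never empties the strip
(`Literature.Barriers.RiemannHypothesis.LindelofBacklund`); nothing in this file bears on the truth of RH.

Topic `NumberTheory/LFunctions`. L. Guth, J. Maynard, *New large value estimates for Dirichlet
polynomials*, Ann. of Math. (2) 203 (2026) = arXiv:2405.20552, **Proposition 6.1** (`S₂` bound):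
"For any choice of `k ∈ ℕ`, `S₂ ⪅_{ε,k} N²|W|² + TN|W|^{2−1/k} + N²|W|²(T^{1/2}/|W|^{3/4})^{1/k}`."
The tree proves the case `k = 4` in the standing regime `T = N^{6/5}` of Proposition 3.1
(`GuthMaynardS2.S2_bound`, `LargeValuesS2Bound.lean`; `k = 4` is the choice made in §12 for Theorem 1.1).
This file proves the case `k = 4` with `T` a FREE parameter: `GuthMaynardS2FreeT.S2_bound_freeT` — for all
`T ≥ T₀(ε,δ)`, all `1 ≤ N ≤ T` and every `T^ε`-separated `W` in an interval of length `T`,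
`|S₂| ≤ C T^δ (N²|W|² + TN|W|^{7/4} + N²T^{1/8}|W|^{29/16})` — the `S₂` input of eq. (12.1) with `T` free
(the companion free-`T` inputs: `S₃`, `GuthMaynard2026_proposition_10_1_holds` in
`GuthMaynardS3BoundAsPrinted.lean`; `E(W)`, Proposition 11.1). The general-`k` statement (Hölder with
exponent `k` and Heath-Brown's theorem for the `k`-th power, as printed) is NOT proved here and is not
typed as a fact.

## Proof

* `S2_bound_of_le_pow` — the range `N ≤ T ≤ N^A`: the tree's proof of `S2_bound` re-run with `T` free.
  Its ingredients are already stated for a general window length: `GuthMaynardS2.norm_S2_le` (`S₂` vs.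
  `∑|B_N(t−t')|²`, the `t₃ ≠ t₁` terms negligible by `T^ε`-separation), `sum_pairs_le_classes`,
  `class_le` (Lemma 6.2 = `sum_sq_norm_coefB_le` with `M ≍ N^η T₀/N`, then (6.3)–(6.5) =
  `sum_sq_norm_dirD_le`: Cauchy–Schwarz twice, the divisor bound, Heath-Brown's theorem
  `HeathBrownDZS.heathBrown_differenceSet`). Only the exponent bookkeeping changes: the dyadic classes cost
  `T^{3η}N^{2η} ≤ N^{(4A+2)η}` (`η = min(δ,1)/(10(4A+2))`), and the error terms `T⁴N^{-2ηj}`,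
  `N³T⁵T^{-εj}` are negligible for `j = 12 + ⌈(2A+2)/η⌉ + ⌈6/ε⌉`.
* `norm_S2_le_trivial` — `|S₂| ≪ N³|W|²` (`|B_N| ≪ 1`, `GuthMaynardSimpleS3.norm_coefB_le_const`).
* `S2_bound_freeT` — `A = ⌈2/δ⌉`: for `T ≤ N^A` the first bound (`N^δ ≤ T^δ`), for `N^A ≤ T` the trivial
  one (`N ≤ T^{1/A} ≤ T^{δ/2}`).

No definition and no named fact is introduced; everything in this file is proved.

## References

* L. Guth, J. Maynard, *New large value estimates for Dirichlet polynomials*, Ann. of Math. (2) 203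
  (2026), no. 2, 623–675; arXiv:2405.20552 (2024): §6 (Proposition 6.1, Lemma 6.2, (6.2)–(6.5)), §12
  (eq. (12.1), "We choose `k = 4`"). [key `GuthMaynard2026`]
* D. R. Heath-Brown, *A large values estimate for Dirichlet polynomials*, J. London Math. Soc. (2) 20
  (1979), 8–18 (via `DoubleZetaSumsHeathBrown.lean`).
-/

noncomputable section

open Real Set Filter Topology Complex MeasureTheory Finset
open scoped FourierTransform ContDiff ComplexConjugate

namespace Literature.NumberTheory.LFunctions

namespace GuthMaynardS2FreeT

open GuthMaynardFourier GuthMaynardEnergy GuthMaynardRFunction Literature.Analysis.Fourier DoubleZetaSums GuthMaynardS2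

section weight

variable {w : ℝ → ℝ}

set_option maxHeartbeats 3200000 in
/-- **Proposition 6.1 (`k = 4`) in the range `N ≤ T ≤ N^A`** (with `N^δ`-losses): for `A ≥ 1`, `ε, δ > 0`
there are `C, N₀` with `|S₂| ≤ C N^δ (N²|W|² + TN|W|^{7/4} + N²T^{1/8}|W|^{29/16})` whenever
`N₀ ≤ N ≤ T ≤ N^A` and `W ⊂ [t₀, t₀+T]` is `T^ε`-separated. Proof = the tree's proof of
`GuthMaynardS2.S2_bound` (`T = N^{6/5}`) re-run with `T` free: `norm_S2_le`, `sum_pairs_le_classes`,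
`class_le` (window parameter `T`), `sum_sq_norm_coefB_le` (Lemma 6.2) and `sum_sq_norm_dirD_le`
(Heath-Brown); the parameters are `η = min(δ,1)/(10(4A+2))` (the classes cost `T^{3η}N^{2η} ≤ N^{(4A+2)η}`),
`j = 12 + ⌈(2A+2)/η⌉ + ⌈6/ε⌉` (`T⁴N^{-2ηj}` and `T⁵T^{-εj}` negligible).
[cite: GuthMaynard2026, Proposition 6.1 and its proof, Section 6] -/
theorem S2_bound_of_le_pow (hw : ContDiff ℝ ∞ w) (hsupp : Function.support w ⊆ Set.Icc 1 2)
    {A : ℝ} (hA1 : 1 ≤ A) {ε : ℝ} (hε : 0 < ε) {δ : ℝ} (hδ : 0 < δ) : ∃ C N₀ : ℝ, ∀ N : ℕ, N₀ ≤ (N : ℝ) →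
      ∀ (T : ℝ), (N : ℝ) ≤ T → T ≤ (N : ℝ) ^ A →
      ∀ (t₀ : ℝ) (W : Finset ℝ), (∀ t ∈ W, t₀ ≤ t ∧ t ≤ t₀ + T) →
      (∀ t ∈ W, ∀ t' ∈ W, t ≠ t' → T ^ ε ≤ |t - t'|) →
      ‖S2 w N W‖ ≤ C * (N : ℝ) ^ δ * ((N : ℝ) ^ 2 * (W.card : ℝ) ^ 2 +
        T * N * (W.card : ℝ) ^ (7 / 4 : ℝ) +
        (N : ℝ) ^ 2 * T ^ (1 / 8 : ℝ) * (W.card : ℝ) ^ (29 / 16 : ℝ)) := by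
  classical
  -- parameters
  have hA0 : 0 < A := by linarith
  set δ₁ : ℝ := min δ 1 with hδ₁
  have hδ₁0 : 0 < δ₁ := lt_min hδ one_pos
  have hδ₁1 : δ₁ ≤ 1 := min_le_right _ _
  have hδ₁δ : δ₁ ≤ δ := min_le_left _ _
  set η : ℝ := δ₁ / (10 * (4 * A + 2)) with hη
  have hη0 : 0 < η := by positivity
  have h4A2 : (6 : ℝ) ≤ 4 * A + 2 := by linarith
  have hη1 : η ≤ 1 / 10 := by
    rw [hη, div_le_iff₀ (by positivity)]; linarith
  have hηA : (4 * A + 2) * η ≤ δ := by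
    have : (4 * A + 2) * η = δ₁ / 10 := by rw [hη]; field_simp
    rw [this]; linarith
  have hAη : A * η ≤ 1 / 4 := by
    have h1 : A * η ≤ (4 * A + 2) * η := by
      have : 0 ≤ (3 * A + 2) * η := by positivity
      linarith
    have h2 : (4 * A + 2) * η = δ₁ / 10 := by rw [hη]; field_simp
    linarith
  set j : ℕ := 12 + ⌈(2 * A + 2) / η⌉₊ + ⌈6 / ε⌉₊ with hj
  have hj12 : 12 ≤ j := by omega
  have hj2 : 2 ≤ j := by omega
  have hjr : (12 : ℝ) ≤ j := by exact_mod_cast hj12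
  have hηj : 2 * A + 2 ≤ η * j := by
    have h1 : ((2 * A + 2) / η : ℝ) ≤ ⌈(2 * A + 2) / η⌉₊ := Nat.le_ceil _
    have h2 : ((⌈(2 * A + 2) / η⌉₊ : ℕ) : ℝ) ≤ j := by
      rw [hj]; push_cast; linarith [Nat.cast_nonneg (α := ℝ) ⌈6 / ε⌉₊]
    calc (2 * A + 2 : ℝ) = η * ((2 * A + 2) / η) := by field_simp
      _ ≤ η * j := mul_le_mul_of_nonneg_left (h1.trans h2) hη0.le
  have hεj : 6 ≤ ε * j := by
    have h1 : (6 / ε : ℝ) ≤ ⌈6 / ε⌉₊ := Nat.le_ceil _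
    have h2 : ((⌈6 / ε⌉₊ : ℕ) : ℝ) ≤ j := by
      rw [hj]; push_cast; linarith [Nat.cast_nonneg (α := ℝ) ⌈4 / η⌉₊]
    calc (6 : ℝ) = ε * (6 / ε) := by field_simp
      _ ≤ ε * j := mul_le_mul_of_nonneg_left (h1.trans h2) hε.le
  have hηj2 : 8 ≤ 2 * η * (j : ℝ) := by linarith [show 2 * η * (j : ℝ) = 2 * (η * j) by ring]
  -- constants from the lemmas
  obtain ⟨CS, hCS0, hCS⟩ := norm_S2_le hw hsupp j
  obtain ⟨CB, hCB0, hCB⟩ := norm_coefB_le hw hsupp hj2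
  obtain ⟨CA, hCA0, hCA⟩ := sum_sq_norm_coefB_le hw hsupp hj2
  obtain ⟨CΦ, TΦ, hCΦ0, hCΦ⟩ := sum_sq_norm_dirD_le hη0
  set Cη : ℝ := 1 / (η * Real.log 2) + 1 with hCη
  have hCη0 : 0 ≤ Cη := by positivity
  set cI : ℝ := Cη * 2 ^ η + 1 with hcI
  set cK : ℝ := Cη * 10 ^ η + 1 with hcK
  have hcI0 : 0 ≤ cI := by positivity
  have hcK0 : 0 ≤ cK := by positivity
  -- the constant and the threshold
  set c₁ : ℝ := CS * CB ^ 2 with hc₁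
  set c₂ : ℝ := CS * CB ^ 2 * 4 ^ j with hc₂
  set c₃ : ℝ := CS * cI * (27 * (CA * CΦ * cK ^ 2)) with hc₃
  set c₄ : ℝ := CS * cI * (CA * (324 * 2 ^ (2 * j - 4) + 6561 * 9 ^ j)) with hc₄
  set c₅ : ℝ := CS * 32 with hc₅
  refine ⟨c₁ + c₂ + c₃ + c₄ + c₅, max (max TΦ 81) 2, fun N hN T hTn hTA t₀ W hwin hsep ↦ ?_⟩
  -- basic quantities
  set n : ℝ := (N : ℝ) with hn
  have hnT : TΦ ≤ n := le_trans ((le_max_left _ _).trans (le_max_left _ _)) hN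
  have hn81 : (81 : ℝ) ≤ n := le_trans ((le_max_right _ _).trans (le_max_left _ _)) hN
  have hn2 : (2 : ℝ) ≤ n := le_trans (le_max_right _ _) hN
  have hn1 : (1 : ℝ) ≤ n := by linarith
  have hn0 : (0 : ℝ) < n := by linarith
  have hNnat : 1 ≤ N := by rw [hn] at hn1; exact_mod_cast hn1
  have hT1 : 1 ≤ T := hn1.trans hTn
  have hT2 : 2 ≤ T := hn2.trans hTn
  have hT0 : 0 < T := by linarith
  have hTΦ : TΦ ≤ T := hnT.trans hTn
  set s : ℝ := T ^ ε with hs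
  have hs1 : 1 ≤ s := Real.one_le_rpow hT1 hε.le
  have hs0 : 0 < s := by linarith
  have hsep1 : ∀ t ∈ W, ∀ t' ∈ W, t ≠ t' → 1 ≤ |t - t'| := fun t ht t' ht' hne ↦
    hs1.trans (hsep t ht t' ht' hne)
  have hdiam : ∀ t ∈ W, ∀ t' ∈ W, |t - t'| ≤ T := by
    intro t ht t' ht'
    have h1 := hwin t ht; have h2 := hwin t' ht'
    rw [abs_le]; constructor <;> linarith [h1.1, h1.2, h2.1, h2.2]
  -- Step 1: `S₂` in terms of `P = ∑ |B|²`
  have hS := hCS N hNnat W s T hs0 hT0.le (fun t ht t' ht' hne ↦ hsep t ht t' ht' hne) hdiam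
  rw [← hn] at hS
  set R : ℝ := (W.card : ℝ) with hR
  have hR0 : 0 ≤ R := Nat.cast_nonneg _
  have hRT : R ≤ T + 1 := card_le_of_window hT0.le hwin hsep1
  have hRT2 : R ≤ 2 * T := by linarith
  set P : ℝ := ∑ t ∈ W, ∑ t' ∈ W, ‖coefB w n (t - t')‖ ^ 2 with hP
  have hP0 : 0 ≤ P := Finset.sum_nonneg fun _ _ ↦ Finset.sum_nonneg fun _ _ ↦ by positivity
  -- the target pieces
  set X₁ : ℝ := n ^ 2 * R ^ 2 with hX₁
  set X₂ : ℝ := T * n * R ^ (7 / 4 : ℝ) with hX₂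
  set X₃ : ℝ := n ^ 2 * T ^ (1 / 8 : ℝ) * R ^ (29 / 16 : ℝ) with hX₃
  have hX₁0 : 0 ≤ X₁ := by positivity
  have hX₂0 : 0 ≤ X₂ := by positivity
  have hX₃0 : 0 ≤ X₃ := by positivity
  set Main : ℝ := X₁ + X₂ + X₃ with hMain
  have hMain0 : 0 ≤ Main := by positivity
  have hnδ : 1 ≤ n ^ δ := Real.one_le_rpow hn1 hδ.le
  set Z : ℝ := n ^ δ * Main with hZ
  have hZ0 : 0 ≤ Z := by positivity
  have hX₁Z : X₁ ≤ Z := by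
    calc X₁ ≤ Main := by rw [hMain]; linarith
      _ ≤ n ^ δ * Main := le_mul_of_one_le_left hMain0 hnδ
  have hMainZ : Main ≤ Z := le_mul_of_one_le_left hMain0 hnδ
  -- Step 2: decomposition of the pairs
  set Θ : ℝ := n ^ (1 - η) with hΘ
  have hΘ1 : 1 ≤ Θ := Real.one_le_rpow hn1 (by linarith)
  have hΘ9 : 9 ≤ Θ := by
    have h1 : (81 : ℝ) ^ (1 / 2 : ℝ) = 9 := by
      rw [show (81 : ℝ) = 9 ^ 2 by norm_num, pow_rpow_eq (by norm_num)]; norm_num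
    calc (9 : ℝ) = 81 ^ (1 / 2 : ℝ) := h1.symm
      _ ≤ n ^ (1 / 2 : ℝ) := Real.rpow_le_rpow (by norm_num) hn81 (by norm_num)
      _ ≤ n ^ (1 - η) := Real.rpow_le_rpow_of_exponent_le hn1 (by linarith)
  set I : ℕ := Nat.log 2 ⌈T⌉₊ + 1 with hI
  have hTceil : 1 ≤ ⌈T⌉₊ := Nat.one_le_iff_ne_zero.mpr (Nat.pos_iff_ne_zero.mp (Nat.ceil_pos.mpr hT0))
  have hTI : T ≤ 2 ^ I := by
    have h1 : (⌈T⌉₊ : ℝ) < 2 ^ (Nat.log 2 ⌈T⌉₊ + 1) := by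
      exact_mod_cast Nat.lt_pow_succ_log_self one_lt_two ⌈T⌉₊
    exact (Nat.le_ceil T).trans h1.le
  have hclasses := sum_pairs_le_classes (fun τ ↦ ‖coefB w n τ‖ ^ 2) (fun _ ↦ by positivity) W hΘ1 hTI hdiam
  set Igood := (Finset.range (I + 1)).filter (fun i ↦ Θ < (2 : ℝ) ^ (i + 1)) with hIgood
  -- the number of classes
  have hIcard : (Igood.card : ℝ) ≤ cI * T ^ η := by
    have h1 : (Igood.card : ℝ) ≤ I + 1 := by
      have : Igood.card ≤ (Finset.range (I + 1)).card := Finset.card_filter_le _ _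
      rw [Finset.card_range] at this
      exact_mod_cast this
    have h2 : ((Nat.log 2 ⌈T⌉₊ : ℕ) : ℝ) + 1 ≤ Cη * (⌈T⌉₊ : ℝ) ^ η := natLog_add_one_le hη0 hTceil
    have h3 : (⌈T⌉₊ : ℝ) ≤ 2 * T := by linarith [Nat.ceil_lt_add_one hT0.le]
    have h4 : (⌈T⌉₊ : ℝ) ^ η ≤ 2 ^ η * T ^ η := by
      rw [← Real.mul_rpow zero_le_two hT0.le]; exact Real.rpow_le_rpow (Nat.cast_nonneg _) h3 hη0.le
    have h5 : (1 : ℝ) ≤ T ^ η := Real.one_le_rpow hT1 hη0.le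
    calc (Igood.card : ℝ) ≤ I + 1 := h1
      _ = (((Nat.log 2 ⌈T⌉₊ : ℕ) : ℝ) + 1) + 1 := by rw [hI]; push_cast; ring
      _ ≤ Cη * (2 ^ η * T ^ η) + T ^ η := add_le_add (h2.trans (mul_le_mul_of_nonneg_left h4 hCη0)) h5
      _ = cI * T ^ η := by rw [hcI]; ring
  -- Step 3: the diagonal and the small differences
  have hB0 : ‖coefB w n 0‖ ^ 2 ≤ CB ^ 2 * n ^ (-(2 * (j : ℝ))) := by
    have h := hCB 0 n hn1
    simp only [abs_zero, add_zero, one_pow, mul_one] at h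
    have h' : ‖coefB w n 0‖ ≤ CB * n ^ (-(j : ℝ)) := by
      rw [Real.rpow_neg hn0.le, Real.rpow_natCast, ← div_eq_mul_inv]; exact h
    calc ‖coefB w n 0‖ ^ 2 ≤ (CB * n ^ (-(j : ℝ))) ^ 2 := pow_le_pow_left₀ (norm_nonneg _) h' 2
      _ = CB ^ 2 * n ^ (-(2 * (j : ℝ))) := by
          rw [mul_pow, ← Real.rpow_natCast (n ^ (-(j : ℝ))) 2, ← Real.rpow_mul hn0.le]; push_cast; ring_nf
  have hsmall : ∀ t ∈ W, ∀ t' ∈ W, (if t ≠ t' ∧ |t - t'| ≤ Θ then ‖coefB w n (t - t')‖ ^ 2 else 0) ≤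
      CB ^ 2 * 4 ^ j * n ^ (-(2 * η * j)) := by
    intro t _ t' _
    split_ifs with h
    · have h1 := hCB (t - t') n hn1
      have h2 : (1 + |t - t'|) ^ j ≤ (2 * Θ) ^ j := pow_le_pow_left₀ (by positivity) (by linarith [h.2]) j
      have e3 : (2 * Θ) ^ j = 2 ^ j * n ^ (-(η * j)) * n ^ j := by
        rw [mul_pow, hΘ, ← Real.rpow_natCast (n ^ (1 - η)) j, ← Real.rpow_mul hn0.le,
          ← Real.rpow_natCast n j, mul_assoc, ← Real.rpow_add hn0]
        congr 2; ring
      have h3 : ‖coefB w n (t - t')‖ ≤ CB * 2 ^ j * n ^ (-(η * j)) := by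
        refine h1.trans ?_
        rw [div_le_iff₀ (by positivity)]
        calc CB * (1 + |t - t'|) ^ j ≤ CB * (2 * Θ) ^ j := mul_le_mul_of_nonneg_left h2 hCB0
          _ = CB * 2 ^ j * n ^ (-(η * j)) * n ^ j := by rw [e3]; ring
      have e4 : (CB * 2 ^ j * n ^ (-(η * j))) ^ 2 = CB ^ 2 * 4 ^ j * n ^ (-(2 * η * j)) := by
        rw [mul_pow, mul_pow, ← pow_mul, ← Real.rpow_natCast (n ^ (-(η * j))) 2, ← Real.rpow_mul hn0.le,
          show (2 : ℝ) ^ (j * 2) = 4 ^ j by rw [mul_comm, pow_mul]; norm_num]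
        congr 1; push_cast; ring
      calc ‖coefB w n (t - t')‖ ^ 2 ≤ (CB * 2 ^ j * n ^ (-(η * j))) ^ 2 := pow_le_pow_left₀ (norm_nonneg _) h3 2
        _ = CB ^ 2 * 4 ^ j * n ^ (-(2 * η * j)) := e4
    · positivity
  have hPsmall : ∑ t ∈ W, ∑ t' ∈ W, (if t ≠ t' ∧ |t - t'| ≤ Θ then ‖coefB w n (t - t')‖ ^ 2 else 0) ≤
      R ^ 2 * (CB ^ 2 * 4 ^ j * n ^ (-(2 * η * j))) := by
    calc ∑ t ∈ W, ∑ t' ∈ W, (if t ≠ t' ∧ |t - t'| ≤ Θ then ‖coefB w n (t - t')‖ ^ 2 else 0)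
        ≤ ∑ t ∈ W, ∑ t' ∈ W, CB ^ 2 * 4 ^ j * n ^ (-(2 * η * j)) :=
          Finset.sum_le_sum fun t ht ↦ Finset.sum_le_sum fun t' ht' ↦ hsmall t ht t' ht'
      _ = R ^ 2 * (CB ^ 2 * 4 ^ j * n ^ (-(2 * η * j))) := by
          simp only [Finset.sum_const, nsmul_eq_mul, hR]; ring
  -- Step 4: the dyadic classes
  set Mmax : ℕ := ⌈9 * n ^ η * T / n⌉₊ with hMmax
  set K : ℕ := Nat.log 2 Mmax + 2 with hK
  have hnηpos : 0 < n ^ η := Real.rpow_pos_of_pos hn0 η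
  have hnη : n ^ η ≤ n := by
    conv_rhs => rw [← Real.rpow_one n]
    exact Real.rpow_le_rpow_of_exponent_le hn1 (by linarith)
  have hMmax1 : 1 ≤ Mmax := by
    rw [hMmax]; refine Nat.one_le_iff_ne_zero.mpr (Nat.pos_iff_ne_zero.mp (Nat.ceil_pos.mpr ?_))
    have h9 : 9 * n ^ η * T / n = 9 * n ^ η * (T / n) := by ring
    rw [h9]; exact mul_pos (by positivity) (div_pos hT0 hn0)
  have hMmaxle : 9 * n ^ η * T / n ≤ (Mmax : ℝ) := Nat.le_ceil _
  have hK2 : ∀ M : ℕ, M ≤ Mmax → 2 * (M : ℝ) ≤ 2 ^ K := by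
    intro M hM
    have h1 : (Mmax : ℝ) < 2 ^ (Nat.log 2 Mmax + 1) := by exact_mod_cast Nat.lt_pow_succ_log_self one_lt_two Mmax
    have h2 : (M : ℝ) ≤ Mmax := by exact_mod_cast hM
    rw [hK, show Nat.log 2 Mmax + 2 = (Nat.log 2 Mmax + 1) + 1 by ring, pow_succ]
    linarith
  have hKbound : (K : ℝ) ≤ cK * T ^ η := by
    have h2 : ((Nat.log 2 Mmax : ℕ) : ℝ) + 1 ≤ Cη * (Mmax : ℝ) ^ η := natLog_add_one_le hη0 hMmax1
    have h3 : (Mmax : ℝ) ≤ 10 * T := by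
      have h4 : 9 * n ^ η * T / n ≤ 9 * T := by
        rw [div_le_iff₀ hn0]
        calc 9 * n ^ η * T = 9 * (n ^ η * T) := by ring
          _ ≤ 9 * (n * T) := by gcongr
          _ = 9 * T * n := by ring
      have := Nat.ceil_lt_add_one (show (0 : ℝ) ≤ 9 * n ^ η * T / n by positivity)
      rw [hMmax]; linarith
    have h4 : (Mmax : ℝ) ^ η ≤ 10 ^ η * T ^ η := by
      rw [← Real.mul_rpow (by norm_num) hT0.le]; exact Real.rpow_le_rpow (Nat.cast_nonneg _) h3 hη0.le
    have h5 : (1 : ℝ) ≤ T ^ η := Real.one_le_rpow hT1 hη0.le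
    calc (K : ℝ) = (((Nat.log 2 Mmax : ℕ) : ℝ) + 1) + 1 := by rw [hK]; push_cast; ring
      _ ≤ Cη * (10 ^ η * T ^ η) + T ^ η := add_le_add (h2.trans (mul_le_mul_of_nonneg_left h4 hCη0)) h5
      _ = cK * T ^ η := by rw [hcK]; ring
  -- uniform bound for each good class (from `class_le`)
  set MainC : ℝ := CA * (K : ℝ) ^ 2 * (CΦ * T ^ η * (3 * n ^ (2 * η) * n ^ (-1 : ℝ) * R ^ 2 +
      27 * n ^ (2 * η) * n ^ (-2 : ℝ) * T * R ^ (7 / 4 : ℝ) +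
      3 * n ^ (2 * η) * n ^ (-1 : ℝ) * T ^ (1 / 8 : ℝ) * R ^ (29 / 16 : ℝ))) with hMainC
  set NeglC : ℝ := CA * R ^ 2 * (324 * 2 ^ (2 * j - 4) * n ^ (-((1 - η) * (2 * (j : ℝ) - 4))) +
    6561 * 9 ^ j * T ^ 4 * n ^ (-(2 * η * j))) with hNeglC
  have hMainC0 : 0 ≤ MainC := by positivity
  have hNeglC0 : 0 ≤ NeglC := by positivity
  have hclass : ∀ i ∈ Igood, ∑ t ∈ W, ∑ t' ∈ W,
      (if (2 : ℝ) ^ i ≤ |t - t'| ∧ |t - t'| ≤ 2 * 2 ^ i then ‖coefB w n (t - t')‖ ^ 2 else 0) ≤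
        MainC + NeglC := by
    intro i hi
    rw [hIgood, Finset.mem_filter, Finset.mem_range] at hi
    obtain ⟨hiI, hiΘ⟩ := hi
    have hiT : (2 : ℝ) ^ i ≤ 3 * T := by
      have h1 : (2 : ℝ) ^ i ≤ 2 ^ I := pow_le_pow_right₀ one_le_two (Nat.lt_succ_iff.mp hiI)
      have h2 : (2 : ℝ) ^ I ≤ 2 * ⌈T⌉₊ := by
        rw [hI, pow_succ']
        have : ((2 ^ Nat.log 2 ⌈T⌉₊ : ℕ) : ℝ) ≤ ⌈T⌉₊ := by
          exact_mod_cast Nat.pow_log_le_self 2 (by omega)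
        push_cast at this; linarith
      have h3 : (⌈T⌉₊ : ℝ) ≤ T + 1 := (Nat.ceil_lt_add_one hT0.le).le
      linarith
    exact class_le hCA0 hCΦ0 hn1 hT1 hη0 hη1 hj12 hΘ9 W hMmaxle hK2
      (fun M K hM hMK T₀ hT₀ Φ hΦ ↦ hCA n hn1 M K hM hMK T₀ hT₀ W Φ hΦ)
      (fun M hM hMT ξ ↦ hCΦ T hTΦ M hM hMT W t₀ hwin hsep1 ξ) hiΘ hiT
  have hPclasses : ∑ i ∈ Igood, ∑ t ∈ W, ∑ t' ∈ W,
      (if (2 : ℝ) ^ i ≤ |t - t'| ∧ |t - t'| ≤ 2 * 2 ^ i then ‖coefB w n (t - t')‖ ^ 2 else 0) ≤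
        cI * T ^ η * (MainC + NeglC) := by
    calc _ ≤ ∑ i ∈ Igood, (MainC + NeglC) := Finset.sum_le_sum hclass
      _ = Igood.card * (MainC + NeglC) := by rw [Finset.sum_const, nsmul_eq_mul]
      _ ≤ cI * T ^ η * (MainC + NeglC) := mul_le_mul_of_nonneg_right hIcard (by positivity)
  -- Step 5: collect
  have hPle : P ≤ R * (CB ^ 2 * n ^ (-(2 * (j : ℝ)))) + R ^ 2 * (CB ^ 2 * 4 ^ j * n ^ (-(2 * η * j))) +
      cI * T ^ η * (MainC + NeglC) := by
    refine hclasses.trans ?_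
    have h1 : (W.card : ℝ) * ‖coefB w n 0‖ ^ 2 ≤ R * (CB ^ 2 * n ^ (-(2 * (j : ℝ)))) :=
      mul_le_mul_of_nonneg_left hB0 hR0
    linarith [h1, hPsmall, hPclasses]
  -- convert `T` powers to `n` powers (`T ≤ n^A`)
  have hTpow : ∀ a : ℝ, 0 ≤ a → T ^ a ≤ n ^ (A * a) := fun a ha ↦ by
    rw [Real.rpow_mul hn0.le]; exact Real.rpow_le_rpow hT0.le hTA ha
  have hn3 : n ^ (3 : ℕ) = n ^ (3 : ℝ) := by rw [← Real.rpow_natCast]; norm_num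
  have hn2' : n ^ (2 : ℕ) = n ^ (2 : ℝ) := by rw [← Real.rpow_natCast]; norm_num
  -- (P1) diagonal
  have hP1 : CS * n ^ 3 * (R * (CB ^ 2 * n ^ (-(2 * (j : ℝ))))) ≤ c₁ * Z := by
    have h1 : n ^ (3 : ℝ) * n ^ (-(2 * (j : ℝ))) ≤ n ^ (2 : ℝ) := by
      rw [← Real.rpow_add hn0]; exact Real.rpow_le_rpow_of_exponent_le hn1 (by linarith)
    have h2 : n ^ (3 : ℝ) * n ^ (-(2 * (j : ℝ))) * R ≤ n ^ (2 : ℝ) * R ^ 2 :=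
      mul_le_mul h1 (natCast_le_sq _) hR0 (Real.rpow_nonneg hn0.le 2)
    have h3 : n ^ (2 : ℝ) * R ^ 2 ≤ Z := by rw [← hn2']; exact hX₁Z
    calc CS * n ^ 3 * (R * (CB ^ 2 * n ^ (-(2 * (j : ℝ))))) = c₁ * (n ^ (3 : ℝ) * n ^ (-(2 * (j : ℝ))) * R) := by
          rw [hn3, hc₁]; ring
      _ ≤ c₁ * Z := mul_le_mul_of_nonneg_left (h2.trans h3) (by positivity)
  -- (P2) small differences
  have hP2 : CS * n ^ 3 * (R ^ 2 * (CB ^ 2 * 4 ^ j * n ^ (-(2 * η * j)))) ≤ c₂ * Z := by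
    have h1 : n ^ (3 : ℝ) * n ^ (-(2 * η * j)) ≤ n ^ (2 : ℝ) := by
      rw [← Real.rpow_add hn0]; exact Real.rpow_le_rpow_of_exponent_le hn1 (by linarith)
    have h2 : n ^ (3 : ℝ) * n ^ (-(2 * η * j)) * R ^ 2 ≤ n ^ (2 : ℝ) * R ^ 2 :=
      mul_le_mul_of_nonneg_right h1 (pow_nonneg hR0 2)
    have h3 : n ^ (2 : ℝ) * R ^ 2 ≤ Z := by rw [← hn2']; exact hX₁Z
    calc CS * n ^ 3 * (R ^ 2 * (CB ^ 2 * 4 ^ j * n ^ (-(2 * η * j)))) =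
        c₂ * (n ^ (3 : ℝ) * n ^ (-(2 * η * j)) * R ^ 2) := by rw [hn3, hc₂]; ring
      _ ≤ c₂ * Z := mul_le_mul_of_nonneg_left (h2.trans h3) (by positivity)
  -- (P3) the main term of the classes
  have hKT : (K : ℝ) ^ 2 * T ^ η ≤ cK ^ 2 * n ^ (A * (3 * η)) := by
    have h1 : (K : ℝ) ^ 2 ≤ (cK * T ^ η) ^ 2 := pow_le_pow_left₀ (Nat.cast_nonneg K) hKbound 2
    calc (K : ℝ) ^ 2 * T ^ η ≤ (cK * T ^ η) ^ 2 * T ^ η := mul_le_mul_of_nonneg_right h1 (by positivity)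
      _ = cK ^ 2 * (T ^ η * T ^ η * T ^ η) := by ring
      _ = cK ^ 2 * T ^ (3 * η) := by
          rw [← Real.rpow_add hT0, ← Real.rpow_add hT0]; ring_nf
      _ ≤ cK ^ 2 * n ^ (A * (3 * η)) := mul_le_mul_of_nonneg_left (hTpow _ (by positivity)) (by positivity)
  have hP3 : CS * n ^ 3 * (cI * T ^ η * MainC) ≤ c₃ * Z := by
    -- `n³ · (3 n^{2η-1} R² + 27 n^{2η-2} T R^{7/4} + 3 n^{2η-1} T^{1/8} R^{29/16}) ≤ 27 n^{2η} Main`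
    have e2 : n ^ (3 : ℝ) * n ^ (-1 : ℝ) = n ^ 2 := by rw [← Real.rpow_add hn0, hn2']; norm_num
    have e3 : n ^ (3 : ℝ) * n ^ (-2 : ℝ) = n := by rw [← Real.rpow_add hn0]; norm_num
    have h1 : n ^ (3 : ℝ) * (3 * n ^ (2 * η) * n ^ (-1 : ℝ) * R ^ 2 + 27 * n ^ (2 * η) * n ^ (-2 : ℝ) * T * R ^ (7 / 4 : ℝ) +
        3 * n ^ (2 * η) * n ^ (-1 : ℝ) * T ^ (1 / 8 : ℝ) * R ^ (29 / 16 : ℝ)) ≤ 27 * n ^ (2 * η) * Main := by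
      have e : n ^ (3 : ℝ) * (3 * n ^ (2 * η) * n ^ (-1 : ℝ) * R ^ 2 + 27 * n ^ (2 * η) * n ^ (-2 : ℝ) * T * R ^ (7 / 4 : ℝ) +
          3 * n ^ (2 * η) * n ^ (-1 : ℝ) * T ^ (1 / 8 : ℝ) * R ^ (29 / 16 : ℝ)) =
          n ^ (2 * η) * (3 * X₁ + 27 * X₂ + 3 * X₃) := by
        calc n ^ (3 : ℝ) * (3 * n ^ (2 * η) * n ^ (-1 : ℝ) * R ^ 2 + 27 * n ^ (2 * η) * n ^ (-2 : ℝ) * T * R ^ (7 / 4 : ℝ) +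
              3 * n ^ (2 * η) * n ^ (-1 : ℝ) * T ^ (1 / 8 : ℝ) * R ^ (29 / 16 : ℝ))
            = n ^ (2 * η) * (3 * ((n ^ (3 : ℝ) * n ^ (-1 : ℝ)) * R ^ 2) + 27 * ((n ^ (3 : ℝ) * n ^ (-2 : ℝ)) * T * R ^ (7 / 4 : ℝ)) +
              3 * ((n ^ (3 : ℝ) * n ^ (-1 : ℝ)) * T ^ (1 / 8 : ℝ) * R ^ (29 / 16 : ℝ))) := by ring
          _ = n ^ (2 * η) * (3 * X₁ + 27 * X₂ + 3 * X₃) := by rw [e2, e3, hX₁, hX₂, hX₃]; ring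
      rw [e, hMain]
      have : 3 * X₁ + 27 * X₂ + 3 * X₃ ≤ 27 * (X₁ + X₂ + X₃) := by linarith
      calc n ^ (2 * η) * (3 * X₁ + 27 * X₂ + 3 * X₃) ≤ n ^ (2 * η) * (27 * (X₁ + X₂ + X₃)) :=
            mul_le_mul_of_nonneg_left this (by positivity)
        _ = _ := by ring
    -- the exponent: `Aη + 3Aη + 2η = (4A+2)η ≤ δ`
    have hexp : T ^ η * ((K : ℝ) ^ 2 * T ^ η) * n ^ (2 * η) ≤ cK ^ 2 * n ^ δ := by
      calc T ^ η * ((K : ℝ) ^ 2 * T ^ η) * n ^ (2 * η) ≤ n ^ (A * η) * (cK ^ 2 * n ^ (A * (3 * η))) * n ^ (2 * η) := by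
            gcongr
            exact hTpow η hη0.le
        _ = cK ^ 2 * (n ^ (A * η) * n ^ (A * (3 * η)) * n ^ (2 * η)) := by ring
        _ = cK ^ 2 * n ^ ((4 * A + 2) * η) := by rw [← Real.rpow_add hn0, ← Real.rpow_add hn0]; ring_nf
        _ ≤ cK ^ 2 * n ^ δ := by
            refine mul_le_mul_of_nonneg_left (Real.rpow_le_rpow_of_exponent_le hn1 hηA) (by positivity)
    have e4 : CS * n ^ 3 * (cI * T ^ η * MainC) = CS * cI * (CA * CΦ) * (T ^ η * ((K : ℝ) ^ 2 * T ^ η)) *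
        (n ^ (3 : ℝ) * (3 * n ^ (2 * η) * n ^ (-1 : ℝ) * R ^ 2 + 27 * n ^ (2 * η) * n ^ (-2 : ℝ) * T * R ^ (7 / 4 : ℝ) +
          3 * n ^ (2 * η) * n ^ (-1 : ℝ) * T ^ (1 / 8 : ℝ) * R ^ (29 / 16 : ℝ))) := by
      rw [hMainC, hn3]; ring
    rw [e4]
    have h0 : 0 ≤ CS * cI * (CA * CΦ) * (T ^ η * ((K : ℝ) ^ 2 * T ^ η)) := by positivity
    calc CS * cI * (CA * CΦ) * (T ^ η * ((K : ℝ) ^ 2 * T ^ η)) * (n ^ (3 : ℝ) * (3 * n ^ (2 * η) * n ^ (-1 : ℝ) * R ^ 2 +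
          27 * n ^ (2 * η) * n ^ (-2 : ℝ) * T * R ^ (7 / 4 : ℝ) + 3 * n ^ (2 * η) * n ^ (-1 : ℝ) * T ^ (1 / 8 : ℝ) * R ^ (29 / 16 : ℝ)))
        ≤ CS * cI * (CA * CΦ) * (T ^ η * ((K : ℝ) ^ 2 * T ^ η)) * (27 * n ^ (2 * η) * Main) :=
          mul_le_mul_of_nonneg_left h1 h0
      _ = CS * cI * (27 * (CA * CΦ)) * (T ^ η * ((K : ℝ) ^ 2 * T ^ η) * n ^ (2 * η)) * Main := by ring
      _ ≤ CS * cI * (27 * (CA * CΦ)) * (cK ^ 2 * n ^ δ) * Main := by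
          refine mul_le_mul_of_nonneg_right (mul_le_mul_of_nonneg_left hexp (by positivity)) hMain0
      _ = c₃ * Z := by rw [hc₃, hZ]; ring
  -- (P4)+(P5) the negligible parts of the classes
  have hP45 : CS * n ^ 3 * (cI * T ^ η * NeglC) ≤ c₄ * Z := by
    have hTη : T ^ η ≤ n ^ (A * η) := hTpow η hη0.le
    have hT4 : T ^ 4 ≤ n ^ (A * 4) := by
      have := hTpow 4 (by norm_num)
      rwa [show ((4 : ℝ)) = (4 : ℕ) by norm_num, Real.rpow_natCast] at this
    have ha : n ^ (3 : ℝ) * n ^ (A * η) * n ^ (-((1 - η) * (2 * (j : ℝ) - 4))) ≤ n ^ (2 : ℝ) := by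
      rw [← Real.rpow_add hn0, ← Real.rpow_add hn0]
      refine Real.rpow_le_rpow_of_exponent_le hn1 ?_
      have : 9 / 10 * 20 ≤ (1 - η) * (2 * (j : ℝ) - 4) := by
        have h1 : (9 / 10 : ℝ) ≤ 1 - η := by linarith
        have h2 : (20 : ℝ) ≤ 2 * (j : ℝ) - 4 := by linarith
        exact mul_le_mul h1 h2 (by norm_num) (by linarith)
      linarith
    have hb : n ^ (3 : ℝ) * n ^ (A * η) * (n ^ (A * 4) * n ^ (-(2 * η * j))) ≤ n ^ (2 : ℝ) := by
      rw [← Real.rpow_add hn0, ← Real.rpow_add hn0, ← Real.rpow_add hn0]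
      refine Real.rpow_le_rpow_of_exponent_le hn1 ?_
      have h1 : 2 * η * (j : ℝ) = 2 * (η * j) := by ring
      linarith [hηj, hAη, h1]
    have h2 : n ^ (2 : ℝ) * R ^ 2 ≤ Z := by rw [← hn2']; exact hX₁Z
    have e : CS * n ^ 3 * (cI * T ^ η * NeglC) =
        CS * cI * (CA * (324 * 2 ^ (2 * j - 4))) * ((n ^ (3 : ℝ) * T ^ η * n ^ (-((1 - η) * (2 * (j : ℝ) - 4)))) * R ^ 2) +
        CS * cI * (CA * (6561 * 9 ^ j)) * ((n ^ (3 : ℝ) * T ^ η * (T ^ 4 * n ^ (-(2 * η * j)))) * R ^ 2) := by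
      rw [hNeglC, hn3]; ring
    rw [e]
    have k1 : 0 ≤ CS * cI * (CA * (324 * 2 ^ (2 * j - 4))) := by positivity
    have k2 : 0 ≤ CS * cI * (CA * (6561 * 9 ^ j)) := by positivity
    have hR2 : 0 ≤ R ^ 2 := pow_nonneg hR0 2
    have ha' : n ^ (3 : ℝ) * T ^ η * n ^ (-((1 - η) * (2 * (j : ℝ) - 4))) ≤ n ^ (2 : ℝ) := by
      refine le_trans ?_ ha
      gcongr
    have hb' : n ^ (3 : ℝ) * T ^ η * (T ^ 4 * n ^ (-(2 * η * j))) ≤ n ^ (2 : ℝ) := by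
      refine le_trans ?_ hb
      gcongr
    have i1 : (n ^ (3 : ℝ) * T ^ η * n ^ (-((1 - η) * (2 * (j : ℝ) - 4)))) * R ^ 2 ≤ Z :=
      (mul_le_mul_of_nonneg_right ha' hR2).trans h2
    have i2 : (n ^ (3 : ℝ) * T ^ η * (T ^ 4 * n ^ (-(2 * η * j)))) * R ^ 2 ≤ Z :=
      (mul_le_mul_of_nonneg_right hb' hR2).trans h2
    calc _ ≤ CS * cI * (CA * (324 * 2 ^ (2 * j - 4))) * Z + CS * cI * (CA * (6561 * 9 ^ j)) * Z :=
          add_le_add (mul_le_mul_of_nonneg_left i1 k1) (mul_le_mul_of_nonneg_left i2 k2)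
      _ = c₄ * Z := by rw [hc₄]; ring
  -- (P6) the `A`-factor terms
  have hc₅0 : 0 ≤ c₅ := by rw [hc₅]; positivity
  have hP6 : CS * n ^ 3 * (R ^ 3 * (1 + T) ^ 4 / s ^ j) ≤ c₅ * Z := by
    have hR2 : 0 ≤ R ^ 2 := pow_nonneg hR0 2
    have h1 : R ^ 3 ≤ 2 * T * R ^ 2 := by
      have : R ^ 3 = R * R ^ 2 := by ring
      rw [this]; exact mul_le_mul_of_nonneg_right hRT2 hR2
    have h2 : (1 + T) ^ 4 ≤ 16 * T ^ 4 := by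
      have : 1 + T ≤ 2 * T := by linarith
      calc (1 + T) ^ 4 ≤ (2 * T) ^ 4 := pow_le_pow_left₀ (by positivity) this 4
        _ = 16 * T ^ 4 := by ring
    have hsj : s ^ j = T ^ (ε * j) := by
      rw [hs, ← Real.rpow_natCast (T ^ ε) j, ← Real.rpow_mul hT0.le]
    have hT5 : T * T ^ 4 = T ^ (5 : ℝ) := by
      rw [show (5 : ℝ) = (5 : ℕ) by norm_num, Real.rpow_natCast]; ring
    -- `n³ T⁵ / T^{εj} ≤ n²` since `T^{εj} ≥ T⁶ ≥ n T⁵`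
    have h3 : n ^ (3 : ℝ) * T ^ (5 : ℝ) / T ^ (ε * j) ≤ n ^ (2 : ℝ) := by
      have h6T : n * T ^ (5 : ℝ) ≤ T ^ (ε * j) := by
        calc n * T ^ (5 : ℝ) ≤ T * T ^ (5 : ℝ) := by gcongr
          _ = T ^ (6 : ℝ) := by
              rw [show (6 : ℝ) = 1 + 5 by norm_num, Real.rpow_add hT0, Real.rpow_one]
          _ ≤ T ^ (ε * j) := Real.rpow_le_rpow_of_exponent_le hT1 (by linarith)
      have hpos : 0 < T ^ (ε * j) := by positivity
      rw [div_le_iff₀ hpos]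
      have e3 : n ^ (3 : ℝ) = n ^ (2 : ℝ) * n := by
        rw [show (3 : ℝ) = 2 + 1 by norm_num, Real.rpow_add hn0, Real.rpow_one]
      rw [e3, mul_assoc]
      exact mul_le_mul_of_nonneg_left h6T (by positivity)
    have h4 : R ^ 3 * (1 + T) ^ 4 ≤ 32 * R ^ 2 * (T * T ^ 4) := by
      calc R ^ 3 * (1 + T) ^ 4 ≤ (2 * T * R ^ 2) * (16 * T ^ 4) :=
            mul_le_mul h1 h2 (pow_nonneg (by linarith) 4) (mul_nonneg (mul_nonneg zero_le_two hT0.le) hR2)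
        _ = 32 * R ^ 2 * (T * T ^ 4) := by ring
    have h5 : 0 < T ^ (ε * j) := by positivity
    have h6 : n ^ (2 : ℝ) * R ^ 2 ≤ Z := by rw [← hn2']; exact hX₁Z
    calc CS * n ^ 3 * (R ^ 3 * (1 + T) ^ 4 / s ^ j)
        ≤ CS * n ^ 3 * (32 * R ^ 2 * (T * T ^ 4) / s ^ j) := by gcongr
      _ = c₅ * ((n ^ (3 : ℝ) * T ^ (5 : ℝ) / T ^ (ε * j)) * R ^ 2) := by
          rw [hT5, hsj, hn3, hc₅]; ring
      _ ≤ c₅ * (n ^ (2 : ℝ) * R ^ 2) :=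
          mul_le_mul_of_nonneg_left (mul_le_mul_of_nonneg_right h3 hR2) hc₅0
      _ ≤ c₅ * Z := mul_le_mul_of_nonneg_left h6 hc₅0
  -- conclusion
  have hPn : CS * n ^ 3 * P ≤ c₁ * Z + c₂ * Z + c₃ * Z + c₄ * Z := by
    have h := mul_le_mul_of_nonneg_left hPle (by positivity : 0 ≤ CS * n ^ 3)
    have e : CS * n ^ 3 * (R * (CB ^ 2 * n ^ (-(2 * (j : ℝ)))) + R ^ 2 * (CB ^ 2 * 4 ^ j * n ^ (-(2 * η * j))) +
        cI * T ^ η * (MainC + NeglC)) =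
        CS * n ^ 3 * (R * (CB ^ 2 * n ^ (-(2 * (j : ℝ))))) + CS * n ^ 3 * (R ^ 2 * (CB ^ 2 * 4 ^ j * n ^ (-(2 * η * j)))) +
        CS * n ^ 3 * (cI * T ^ η * MainC) + CS * n ^ 3 * (cI * T ^ η * NeglC) := by ring
    rw [e] at h
    linarith [hP1, hP2, hP3, hP45]
  have hfinal : ‖S2 w N W‖ ≤ (c₁ + c₂ + c₃ + c₄ + c₅) * Z := by
    refine hS.trans ?_
    have e : CS * n ^ 3 * (P + R ^ 3 * (1 + T) ^ 4 / s ^ j) =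
        CS * n ^ 3 * P + CS * n ^ 3 * (R ^ 3 * (1 + T) ^ 4 / s ^ j) := by ring
    rw [e]
    linarith [hPn, hP6]
  calc ‖S2 w N W‖ ≤ (c₁ + c₂ + c₃ + c₄ + c₅) * Z := hfinal
    _ = (c₁ + c₂ + c₃ + c₄ + c₅) * n ^ δ * Main := by rw [hZ]; ring


/-- **The trivial bound `|S₂| ≪ N³|W|²`** for `T^ε`-separated `W` in an interval of length `T ≥ 1`:
`|B_N| ≪ 1` (`GuthMaynardSimpleS3.norm_coefB_le_const`) in `GuthMaynardS2.norm_S2_le`, the terms with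
`t₃ ≠ t₁` being negligible (`|W|³(1+T)⁴T^{-εj} ≤ 32|W|²` for `εj ≥ 5`).
[cite: GuthMaynard2026, Section 6, proof of Proposition 6.1 (first display)] -/
theorem norm_S2_le_trivial (hw : ContDiff ℝ ∞ w) (hsupp : Function.support w ⊆ Set.Icc 1 2)
    {ε : ℝ} (hε : 0 < ε) : ∃ C, 0 ≤ C ∧ ∀ (N : ℕ), 1 ≤ N → ∀ (T : ℝ), 1 ≤ T →
      ∀ (t₀ : ℝ) (W : Finset ℝ), (∀ t ∈ W, t₀ ≤ t ∧ t ≤ t₀ + T) →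
      (∀ t ∈ W, ∀ t' ∈ W, t ≠ t' → T ^ ε ≤ |t - t'|) →
      ‖S2 w N W‖ ≤ C * (N : ℝ) ^ 3 * (W.card : ℝ) ^ 2 := by
  set j : ℕ := ⌈5 / ε⌉₊ with hj
  have hεj : 5 ≤ ε * j := by
    have h1 : (5 / ε : ℝ) ≤ ⌈5 / ε⌉₊ := Nat.le_ceil _
    calc (5 : ℝ) = ε * (5 / ε) := by field_simp
      _ ≤ ε * j := mul_le_mul_of_nonneg_left h1 hε.le
  obtain ⟨CS, hCS0, hCS⟩ := norm_S2_le hw hsupp j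
  obtain ⟨c, hc0, hc⟩ := GuthMaynardSimpleS3.norm_coefB_le_const hw hsupp
  refine ⟨CS * (c ^ 2 + 32), by positivity, fun N hN T hT1 t₀ W hwin hsep ↦ ?_⟩
  have hT0 : 0 < T := by linarith
  set s : ℝ := T ^ ε with hs
  have hs1 : 1 ≤ s := Real.one_le_rpow hT1 hε.le
  have hs0 : 0 < s := by linarith
  have hsep1 : ∀ t ∈ W, ∀ t' ∈ W, t ≠ t' → 1 ≤ |t - t'| := fun t ht t' ht' hne ↦
    hs1.trans (hsep t ht t' ht' hne)
  have hdiam : ∀ t ∈ W, ∀ t' ∈ W, |t - t'| ≤ T := by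
    intro t ht t' ht'
    have h1 := hwin t ht; have h2 := hwin t' ht'
    rw [abs_le]; constructor <;> linarith [h1.1, h1.2, h2.1, h2.2]
  have hS := hCS N hN W s T hs0 hT0.le (fun t ht t' ht' hne ↦ hsep t ht t' ht' hne) hdiam
  set R : ℝ := (W.card : ℝ) with hR
  have hR0 : 0 ≤ R := Nat.cast_nonneg _
  have hRT : R ≤ T + 1 := card_le_of_window hT0.le hwin hsep1
  have hRT2 : R ≤ 2 * T := by linarith
  have hn0 : (0 : ℝ) ≤ (N : ℝ) ^ 3 := by positivity
  -- the sum of `|B|²`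
  have hP : ∑ t ∈ W, ∑ t' ∈ W, ‖coefB w N (t - t')‖ ^ 2 ≤ c ^ 2 * R ^ 2 := by
    calc ∑ t ∈ W, ∑ t' ∈ W, ‖coefB w N (t - t')‖ ^ 2 ≤ ∑ t ∈ W, ∑ t' ∈ W, c ^ 2 :=
          Finset.sum_le_sum fun t _ ↦ Finset.sum_le_sum fun t' _ ↦
            pow_le_pow_left₀ (norm_nonneg _) (hc N hN _) 2
      _ = c ^ 2 * R ^ 2 := by simp only [Finset.sum_const, nsmul_eq_mul, hR]; ring
  -- the negligible part
  have hsj : s ^ j = T ^ (ε * j) := by rw [hs, ← Real.rpow_natCast (T ^ ε) j, ← Real.rpow_mul hT0.le]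
  have hnegl : R ^ 3 * (1 + T) ^ 4 / s ^ j ≤ 32 * R ^ 2 := by
    have h1 : R ^ 3 ≤ 2 * T * R ^ 2 := by
      have : R ^ 3 = R * R ^ 2 := by ring
      rw [this]; exact mul_le_mul_of_nonneg_right hRT2 (pow_nonneg hR0 2)
    have h2 : (1 + T) ^ 4 ≤ 16 * T ^ 4 := by
      have : 1 + T ≤ 2 * T := by linarith
      calc (1 + T) ^ 4 ≤ (2 * T) ^ 4 := pow_le_pow_left₀ (by positivity) this 4
        _ = 16 * T ^ 4 := by ring
    have h3 : T * T ^ 4 ≤ T ^ (ε * j) := by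
      calc T * T ^ 4 = T ^ (5 : ℝ) := by rw [show (5 : ℝ) = (5 : ℕ) by norm_num, Real.rpow_natCast]; ring
        _ ≤ T ^ (ε * j) := Real.rpow_le_rpow_of_exponent_le hT1 hεj
    have hpos : 0 < s ^ j := by positivity
    rw [div_le_iff₀ hpos, hsj]
    calc R ^ 3 * (1 + T) ^ 4 ≤ (2 * T * R ^ 2) * (16 * T ^ 4) :=
          mul_le_mul h1 h2 (by positivity) (by positivity)
      _ = 32 * R ^ 2 * (T * T ^ 4) := by ring
      _ ≤ 32 * R ^ 2 * T ^ (ε * j) := by gcongr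
  calc ‖S2 w N W‖ ≤ CS * (N : ℝ) ^ 3 * (∑ t ∈ W, ∑ t' ∈ W, ‖coefB w N (t - t')‖ ^ 2 +
        R ^ 3 * (1 + T) ^ 4 / s ^ j) := hS
    _ ≤ CS * (N : ℝ) ^ 3 * (c ^ 2 * R ^ 2 + 32 * R ^ 2) := by gcongr
    _ = CS * (c ^ 2 + 32) * (N : ℝ) ^ 3 * R ^ 2 := by ring

/-- **Guth–Maynard Proposition 6.1 with `k = 4`, `T` free.** For every smooth `w` supported in `[1,2]`
and every `ε, δ > 0` there are `C, T₀` such that for all `T ≥ T₀`, all `1 ≤ N ≤ T` and every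
`T^ε`-separated `W` in an interval of length `T`,
`|S₂| ≤ C T^δ (N²|W|² + TN|W|^{7/4} + N²T^{1/8}|W|^{29/16})` — the printed
"`S₂ ⪅_{ε,k} N²|W|² + TN|W|^{2−1/k} + N²|W|²(T^{1/2}/|W|^{3/4})^{1/k}`" at `k = 4`, with `T` a free
parameter (the tree's `GuthMaynardS2.S2_bound` is the case `T = N^{6/5}`; the printed statement has `k`
free as well, which is NOT proved here). Proof: `S2_bound_of_le_pow` with `A = ⌈2/δ⌉` in the range
`T ≤ N^A` (`N^δ ≤ T^δ`), and the trivial bound `|S₂| ≪ N³|W|² ≤ T^{1/A}N²|W|² ≤ T^{δ/2}N²|W|²`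
(`norm_S2_le_trivial`) in the range `N^A ≤ T`. [cite: GuthMaynard2026, Proposition 6.1] -/
theorem S2_bound_freeT (hw : ContDiff ℝ ∞ w) (hsupp : Function.support w ⊆ Set.Icc 1 2)
    {ε : ℝ} (hε : 0 < ε) {δ : ℝ} (hδ : 0 < δ) :
    ∃ C T₀ : ℝ, ∀ T : ℝ, T₀ ≤ T → ∀ N : ℕ, 1 ≤ N → (N : ℝ) ≤ T → ∀ (t₀ : ℝ) (W : Finset ℝ),
      (∀ t ∈ W, t₀ ≤ t ∧ t ≤ t₀ + T) →
      (∀ t ∈ W, ∀ t' ∈ W, t ≠ t' → T ^ ε ≤ |t - t'|) →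
      ‖S2 w N W‖ ≤ C * T ^ δ * ((N : ℝ) ^ 2 * (W.card : ℝ) ^ 2 +
        T * N * (W.card : ℝ) ^ (7 / 4 : ℝ) +
        (N : ℝ) ^ 2 * T ^ (1 / 8 : ℝ) * (W.card : ℝ) ^ (29 / 16 : ℝ)) := by
  set a : ℕ := ⌈2 / δ⌉₊ with ha
  have ha1 : 1 ≤ a := Nat.one_le_iff_ne_zero.mpr (Nat.ceil_pos.mpr (by positivity)).ne'
  have ha0 : a ≠ 0 := by omega
  have haδ : 2 / δ ≤ (a : ℝ) := Nat.le_ceil _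
  have hA1 : (1 : ℝ) ≤ (a : ℝ) := by exact_mod_cast ha1
  obtain ⟨C₁, hC₁0, hC₁⟩ := norm_S2_le_trivial hw hsupp hε
  obtain ⟨C₂, N₀, hC₂⟩ := S2_bound_of_le_pow hw hsupp hA1 hε hδ
  set M : ℝ := max N₀ 1 with hM
  have hM1 : 1 ≤ M := le_max_right _ _
  have hM0 : 0 ≤ M := by linarith
  refine ⟨C₁ + max C₂ 0, max 1 (M ^ a), fun T hT N hN hNT t₀ W hwin hsep ↦ ?_⟩
  have hT1 : 1 ≤ T := (le_max_left _ _).trans hT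
  have hTM : M ^ a ≤ T := (le_max_right _ _).trans hT
  have hT0 : 0 < T := by linarith
  have hn1 : (1 : ℝ) ≤ N := by exact_mod_cast hN
  have hn0 : (0 : ℝ) < N := by linarith
  have hK0 : 0 ≤ (W.card : ℝ) := Nat.cast_nonneg _
  have hTδ1 : 1 ≤ T ^ δ := Real.one_le_rpow hT1 hδ.le
  set Main : ℝ := (N : ℝ) ^ 2 * (W.card : ℝ) ^ 2 + T * N * (W.card : ℝ) ^ (7 / 4 : ℝ) +
    (N : ℝ) ^ 2 * T ^ (1 / 8 : ℝ) * (W.card : ℝ) ^ (29 / 16 : ℝ) with hMain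
  have hMain0 : 0 ≤ Main := by rw [hMain]; positivity
  have hC₂le : C₂ ≤ max C₂ 0 := le_max_left _ _
  have hC₂0 : 0 ≤ max C₂ 0 := le_max_right _ _
  have hNa : (N : ℝ) ^ (a : ℝ) = (N : ℝ) ^ a := Real.rpow_natCast _ _
  rcases le_or_gt T ((N : ℝ) ^ a) with hcase | hcase
  · -- the range `T ≤ N^a`
    have hMN : M ≤ N := le_of_pow_le_pow_left₀ ha0 hn0.le (hTM.trans hcase)
    have hN₀N : N₀ ≤ N := (le_max_left _ _).trans hMN
    have hTA : T ≤ (N : ℝ) ^ (a : ℝ) := by rw [hNa]; exact hcase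
    have h := hC₂ N hN₀N T hNT hTA t₀ W hwin hsep
    have hNδ : (N : ℝ) ^ δ ≤ T ^ δ := Real.rpow_le_rpow hn0.le hNT hδ.le
    calc ‖S2 w N W‖ ≤ C₂ * (N : ℝ) ^ δ * Main := h
      _ ≤ max C₂ 0 * (N : ℝ) ^ δ * Main := by gcongr
      _ ≤ max C₂ 0 * T ^ δ * Main := by gcongr
      _ ≤ (C₁ + max C₂ 0) * T ^ δ * Main := by gcongr; linarith
  · -- the range `N^a ≤ T`: trivial bound, `N ≤ T^{1/a} ≤ T^{δ/2}`
    have hNT' : (N : ℝ) ≤ T ^ δ := by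
      have h1 : (N : ℝ) = ((N : ℝ) ^ a) ^ ((a : ℝ)⁻¹) := (Real.pow_rpow_inv_natCast hn0.le ha0).symm
      have h2 : ((N : ℝ) ^ a) ^ ((a : ℝ)⁻¹) ≤ T ^ ((a : ℝ)⁻¹) :=
        Real.rpow_le_rpow (by positivity) hcase.le (by positivity)
      have h3 : T ^ ((a : ℝ)⁻¹) ≤ T ^ δ := by
        refine Real.rpow_le_rpow_of_exponent_le hT1 ?_
        rw [inv_le_comm₀ (by positivity) hδ]
        calc δ⁻¹ = 1 / δ := (one_div δ).symm
          _ ≤ 2 / δ := by gcongr; norm_num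
          _ ≤ a := haδ
      linarith
    have h1 : ‖S2 w N W‖ ≤ C₁ * (N : ℝ) ^ 3 * (W.card : ℝ) ^ 2 := hC₁ N hN T hT1 t₀ W hwin hsep
    have h2 : (N : ℝ) ^ 3 * (W.card : ℝ) ^ 2 ≤ T ^ δ * Main := by
      calc (N : ℝ) ^ 3 * (W.card : ℝ) ^ 2 = (N : ℝ) * ((N : ℝ) ^ 2 * (W.card : ℝ) ^ 2) := by ring
        _ ≤ T ^ δ * ((N : ℝ) ^ 2 * (W.card : ℝ) ^ 2) := by gcongr
        _ ≤ T ^ δ * Main := by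
            gcongr
            rw [hMain]
            have : 0 ≤ T * N * (W.card : ℝ) ^ (7 / 4 : ℝ) + (N : ℝ) ^ 2 * T ^ (1 / 8 : ℝ) * (W.card : ℝ) ^ (29 / 16 : ℝ) := by
              positivity
            linarith
    calc ‖S2 w N W‖ ≤ C₁ * (N : ℝ) ^ 3 * (W.card : ℝ) ^ 2 := h1
      _ = C₁ * ((N : ℝ) ^ 3 * (W.card : ℝ) ^ 2) := by ring
      _ ≤ C₁ * (T ^ δ * Main) := by gcongr
      _ = C₁ * T ^ δ * Main := by ring
      _ ≤ (C₁ + max C₂ 0) * T ^ δ * Main := by gcongr; linarith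

end weight

end GuthMaynardS2FreeT

end Literature.NumberTheory.LFunctions

end
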